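import Literature.NumberTheory.EllipticCurves.LambdaAdicSelmerDataTorsionPowReduce
import HarnessLib

/-!
# `H¹` of the pushforward's level maps is semilinear for the scalar actions on cohomology:
# `H¹(f_σ) ∘ H¹([a]_{Λ/I_σ} •) = H¹([a]_{A_{m,k}} •) ∘ H¹(f_σ)` (theorems only)

Topic `NumberTheory/EllipticCurves` (sequel of `LambdaAdicSelmerDataTorsionPowReduce`). Cell `pub/bsd-print-x9`, seat `bsd-line-x9-p2`
(g3): STUB A of the shared μ-skeleton v3. lit g33's cite-only (F-411) (tranche 5 file B, design 17:45:47Z) types CGLS22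
Rem. 4.1.4 verbatim — «`κ_∞` and `κ₁^{Hg}` generate the same `Λ`-submodule»: `κ.one = a • Φ′(z)` and `Φ′(z) = b • κ.one` with
`• = T.smulFamily` — so the LINK `fH1 k (κ.one (σ k)) = ctrlLevel z k` of `stub_howardInputs` passes through a SCALAR:
`fH1 (a • Φ z) = [a] • fH1 (Φ z)`. This file records that semilinearity for the level maps `shapiroToEisensteinTwistLe`:

* `map_shapiroToEisensteinTwistLe_map_coeffTwistSMulHom` : for `a ∈ Λ`,
  `H¹(f_σ) (H¹([a]_{Λ/I_σ} •) y) = H¹([a]_{A_{m,k}} •) (H¹(f_σ) y)` (cocycle level: `f_σ ([a] • m) = [a] • f_σ m`);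
* `map_shapiroToEisensteinTwistLe_smulFamily` : the same with the source scalar action spelled `AdicTower.smulFamily` of
  the Shapiro `coeffAdicTower` (`smulFamily_coeffAdicTower`), target spelled `eisensteinTwistSMulHom` (`coeffTwistSMulHom_eisenstein`).
Theorems only; no `sorry`. BSD is not proved by any of this.

References: [Howard2004HeegnerKolyvagin] B. Howard, Compositio Math. 140 (2004), Rem. 1.2.4 (i),(iii) (arXiv p. 7, L13–27), §2.2
Def. 2.2.3; [CastellaGrossiLeeSkinner2022] Rem. 4.1.4; [SerreGaloisCohomology1997] I §2.2.
-/

noncomputable section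

open scoped Topology Classical ContRepresentation
open Field CategoryTheory IsLocalRing

namespace Literature.NumberTheory.EllipticCurves.ZpExtension

open Literature.NumberTheory.GaloisRepresentations
open Literature.NumberTheory.GaloisCohomology.Howard2004

variable {K : Type} [Field K] [NumberField K] {V : WeierstrassCurve K} [V.IsElliptic] {p : ℕ} [hp : Fact p.Prime]
  (κ : ZpExtension K p)
  (t : ∀ k, (V.torsionGaloisModule ((p : ℤ) ^ (k + 1))).toContRepresentation →ⁱL
    (V.torsionGaloisModule ((p : ℤ) ^ k)).toContRepresentation)
  (hts : ∀ k, Function.Surjective (t k)) {m : ℕ} (hm : 1 ≤ m)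

omit [NumberField K] [V.IsElliptic] in
/-- **`H¹(f_σ) ∘ H¹([a]_{Λ/I_σ} •) = H¹([a]_{A_{m,k}} •) ∘ H¹(f_σ)`** for `a ∈ Λ` (on cocycles: `f_σ` is semilinear along
`Λ/I_σ ↠ A_{m,k}`, `shapiroToEisensteinTwistLe_smul`, and `[a]_{Λ/I_σ} ↦ [a]_{A_{m,k}}`, `shapiroToEisensteinCoeff_mk`).
[cite: Howard2004HeegnerKolyvagin, Rem. 1.2.4 (i),(iii) (arXiv p. 7, L13–27)] [cite: SerreGaloisCohomology1997, I §2.2] -/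
theorem map_shapiroToEisensteinTwistLe_map_coeffTwistSMulHom (σ k : ℕ) (hσ : k ≤ σ)
    (hle : shapiroIdeal p σ ≤ Ideal.span {(PowerSeries.X ^ m + PowerSeries.C (p : ℤ_[p]) : IwasawaAlgebra p)} ⊔
      Ideal.span {PowerSeries.C ((p : ℤ_[p]) ^ k)}) (a : IwasawaAlgebra p)
    (y : galoisCohomology (κ.coeffTwist (V.torsionGaloisModule ((p : ℤ) ^ σ)) (coeffLevelUnit (shapiroIdeal p) σ) σ
      (mk_one_add_X_pow_prime_pow_eq_one (shapiroIdeal p σ) (omega_mem_shapiroIdeal p σ))) 1) :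
    galoisCohomology.map (κ.shapiroToEisensteinTwistLe V hm σ k hσ hle) 1
        (galoisCohomology.map (κ.coeffTwistSMulHom (V.torsionGaloisModule ((p : ℤ) ^ σ))
          (mk_one_add_X_pow_prime_pow_eq_one (shapiroIdeal p σ) (omega_mem_shapiroIdeal p σ))
          (Ideal.Quotient.mk (shapiroIdeal p σ) a)) 1 y) =
      galoisCohomology.map (κ.coeffTwistSMulHom (V.torsionGaloisModule ((p : ℤ) ^ k))
          (onePlusT_pow_prime_pow_eisensteinLevel (p := p) hm k) (Ideal.Quotient.mk _ a)) 1
        (galoisCohomology.map (κ.shapiroToEisensteinTwistLe V hm σ k hσ hle) 1 y) := by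
  obtain ⟨φ, rfl⟩ := oneCocycleClass_surjective _ y
  set Rf : (κ.coeffTwist (V.torsionGaloisModule ((p : ℤ) ^ σ)) (coeffLevelUnit (shapiroIdeal p) σ) σ
      (mk_one_add_X_pow_prime_pow_eq_one (shapiroIdeal p σ) (omega_mem_shapiroIdeal p σ))).toTopRep ⟶
      (κ.eisensteinTwist (V.torsionGaloisModule ((p : ℤ) ^ k)) hm k).toTopRep :=
    TopRep.ofHom ⟨(κ.shapiroToEisensteinTwistLe V hm σ k hσ hle).toContinuousLinearMap,
      (κ.shapiroToEisensteinTwistLe V hm σ k hσ hle).isIntertwining'⟩ with hRf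
  set Ra : (κ.coeffTwist (V.torsionGaloisModule ((p : ℤ) ^ σ)) (coeffLevelUnit (shapiroIdeal p) σ) σ
      (mk_one_add_X_pow_prime_pow_eq_one (shapiroIdeal p σ) (omega_mem_shapiroIdeal p σ))).toTopRep ⟶
      (κ.coeffTwist (V.torsionGaloisModule ((p : ℤ) ^ σ)) (coeffLevelUnit (shapiroIdeal p) σ) σ
      (mk_one_add_X_pow_prime_pow_eq_one (shapiroIdeal p σ) (omega_mem_shapiroIdeal p σ))).toTopRep :=
    TopRep.ofHom ⟨(κ.coeffTwistSMulHom (V.torsionGaloisModule ((p : ℤ) ^ σ))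
      (mk_one_add_X_pow_prime_pow_eq_one (shapiroIdeal p σ) (omega_mem_shapiroIdeal p σ))
      (Ideal.Quotient.mk (shapiroIdeal p σ) a)).toContinuousLinearMap,
      (κ.coeffTwistSMulHom (V.torsionGaloisModule ((p : ℤ) ^ σ))
      (mk_one_add_X_pow_prime_pow_eq_one (shapiroIdeal p σ) (omega_mem_shapiroIdeal p σ))
      (Ideal.Quotient.mk (shapiroIdeal p σ) a)).isIntertwining'⟩ with hRa
  set Ra' : (κ.eisensteinTwist (V.torsionGaloisModule ((p : ℤ) ^ k)) hm k).toTopRep ⟶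
      (κ.eisensteinTwist (V.torsionGaloisModule ((p : ℤ) ^ k)) hm k).toTopRep :=
    TopRep.ofHom ⟨(κ.coeffTwistSMulHom (V.torsionGaloisModule ((p : ℤ) ^ k))
      (onePlusT_pow_prime_pow_eisensteinLevel (p := p) hm k) (Ideal.Quotient.mk _ a)).toContinuousLinearMap,
      (κ.coeffTwistSMulHom (V.torsionGaloisModule ((p : ℤ) ^ k))
      (onePlusT_pow_prime_pow_eisensteinLevel (p := p) hm k) (Ideal.Quotient.mk _ a)).isIntertwining'⟩ with hRa'
  change cohomologyMap Rf 1 (cohomologyMap Ra 1 (oneCocycleClass _ φ)) =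
    cohomologyMap Ra' 1 (cohomologyMap Rf 1 (oneCocycleClass _ φ))
  rw [cohomologyMap_oneCocycleClass, cohomologyMap_oneCocycleClass, cohomologyMap_oneCocycleClass,
    cohomologyMap_oneCocycleClass]
  refine congrArg _ (Subtype.ext (ContinuousMap.ext fun g ↦ ?_))
  rw [pullback_id_resIdHom_apply, pullback_id_resIdHom_apply, pullback_id_resIdHom_apply, pullback_id_resIdHom_apply]
  change κ.shapiroToEisensteinTwistLe V hm σ k hσ hle ((Ideal.Quotient.mk (shapiroIdeal p σ) a) • φ.1 g) =
    (Ideal.Quotient.mk (Ideal.span {(PowerSeries.X ^ m + PowerSeries.C (p : ℤ_[p]) : IwasawaAlgebra p)} ⊔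
      Ideal.span {PowerSeries.C ((p : ℤ_[p]) ^ k)}) a) • κ.shapiroToEisensteinTwistLe V hm σ k hσ hle (φ.1 g)
  rw [shapiroToEisensteinTwistLe_smul, shapiroToEisensteinCoeff_mk]

omit [NumberField K] [V.IsElliptic] in
/-- **The same in tower currency**: for the Shapiro `coeffAdicTower` `T` and a family `x`,
`H¹(f_σ) ((T.smulFamily a x) σ) = H¹(eisensteinTwistSMulHom [a]) (H¹(f_σ) (x σ))` — `fH1` of the pushforward carries the
source's `Λ`-action on families to the target's `A_{m,k}`-action on `H¹(K, T_𝔮/𝔪^{e_k})`.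
[cite: Howard2004HeegnerKolyvagin, Rem. 1.2.4 (iii) and §2.2 Def. 2.2.3] [cite: CastellaGrossiLeeSkinner2022, Rem. 4.1.4] -/
theorem map_shapiroToEisensteinTwistLe_smulFamily (σ k : ℕ) (hσ : k ≤ σ)
    (hle : shapiroIdeal p σ ≤ Ideal.span {(PowerSeries.X ^ m + PowerSeries.C (p : ℤ_[p]) : IwasawaAlgebra p)} ⊔
      Ideal.span {PowerSeries.C ((p : ℤ_[p]) ^ k)}) (a : IwasawaAlgebra p)
    (x : ∀ j, galoisCohomology ((κ.coeffAdicTower (fun j ↦ V.torsionGaloisModule ((p : ℤ) ^ j)) t (shapiroIdeal p)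
      (shapiroIdeal_succ_le p) (fun j ↦ j) (omega_mem_shapiroIdeal p) (fun j ↦ j * p ^ j + j)
      (maximalIdeal_pow_le_shapiroIdeal p) hts).ρ j) 1) :
    galoisCohomology.map (κ.shapiroToEisensteinTwistLe V hm σ k hσ hle) 1
        ((κ.coeffAdicTower (fun j ↦ V.torsionGaloisModule ((p : ℤ) ^ j)) t (shapiroIdeal p) (shapiroIdeal_succ_le p)
          (fun j ↦ j) (omega_mem_shapiroIdeal p) (fun j ↦ j * p ^ j + j) (maximalIdeal_pow_le_shapiroIdeal p) hts).smulFamily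
          a x σ) =
      galoisCohomology.map (κ.eisensteinTwistSMulHom (V.torsionGaloisModule ((p : ℤ) ^ k)) hm k (Ideal.Quotient.mk _ a)) 1
        (galoisCohomology.map (κ.shapiroToEisensteinTwistLe V hm σ k hσ hle) 1 (x σ)) := by
  rw [smulFamily_coeffAdicTower, ← coeffTwistSMulHom_eisenstein]
  exact κ.map_shapiroToEisensteinTwistLe_map_coeffTwistSMulHom hm σ k hσ hle a (x σ)

end Literature.NumberTheory.EllipticCurves.ZpExtension

end
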